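import Summits.HodgeConjecture.HodgeConjecture.Theorems.CurveNetMordellWeilVerticalSupportMiddleHardness
import Summits.HodgeConjecture.HodgeConjecture.Theorems.CurveNetMordellWeilVerticalSupportMiddleLever

/-!
# Route CurveNetMordellWeil — what the crux `VerticalSupportMiddle` AS TYPED is: `OddConiveauOne ∧ NetVerticality`
(evidence for item stmt-HodgeConjecture-2782; `--supports` it; lead prover of line `tangential-carriers-period-syzygies`,
2026-08-16)

Granted the TRANSFER (`OddConiveauOne → NetVerticality → GeneralVerticality`: coniveau one on odd-dimensional varieties plus
vertical support on honest curve nets give pointwise vertical support for every surjective `pr : X^{2q} ⟶ ℙ^{2q-1}` — a printed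
theorem, Deligne descent + dimension bookkeeping, the line's stub 2), the crux item stmt-HodgeConjecture-2782 as typed is
EQUIVALENT to the conjunction of

* `OddConiveauOne` — every rational `(p,p)`-class on a smooth projective `(2p+1)`-fold, `p ≥ 1`, has coniveau `≥ 1`
  (the Stein artefact of the `∀ surjective pr` typing; = HC(p) modulo `N¹` on odd-dimensional varieties), and
* `NetVerticality` (`C⁺`) — every rational `(q,q)`-class on the total space of a curve net over `ℙ^{2q-1}` (`q ≥ 2`) is
  supported on the preimage of a hypersurface (= middle-degree HC for curve-fibred `2q`-folds modulo nothing).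

`→`: the landed `verticalSupportMiddle_imp_coniveau_one_odd` (hardness file) and `verticalSupportMiddle_imp_netVerticality`
(lever file). `←`: the transfer gives `GeneralVerticality`, and every generator of the span of rational `(q,q)`-classes then lies
in the vertical summand of the crux's conclusion (the line's composition `VerticalSupportMiddle_of`, inlined). So a line for this
crux must prove `NetVerticality` itself; levers that are structure theorems about vertical classes (dead lines `Sketch`,
`tangential-carriers-period-syzygies`) are the crux restated.
-/

noncomputable section

-- `Summit.HodgeConjecture.HodgeConjecture.Theorems` is the mandated namespace (single-problem summit: Problem =
-- Summit), which `linter.dupNamespace` flags; off tree-wide in the lakefile, restated for stand-alone elaboration.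
set_option linter.dupNamespace false

open CategoryTheory AlgebraicGeometry
open Literature.AlgebraicGeometry Literature.AlgebraicGeometry.Motives Literature.AlgebraicGeometry.HodgeTheory
open Summit.HodgeConjecture.HodgeConjecture.Theses.CurveNetMordellWeil (VerticalSupportMiddle)

namespace Summit.HodgeConjecture.HodgeConjecture.Theorems

/-- **The crux AS TYPED is `OddConiveauOne ∧ NetVerticality`, granted the transfer.** Hypothesis: the Stein-free transfer
`OddConiveauOne → NetVerticality → GeneralVerticality` (stub 2 of line `tangential-carriers-period-syzygies`, a printed
theorem). Conclusion: `VerticalSupportMiddle ↔ (OddConiveauOne ∧ NetVerticality)`, all three statements expanded verbatim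
from the line skeleton. -/
theorem verticalSupportMiddle_iff_of_transfer :
    ((∀ ⦃p : ℕ⦄ ⦃B : SchemeOver ℂ⦄, 1 ≤ p → IsSmoothProjective (2 * p + 1) B →
        ∀ c : complexBetti B (2 * p), IsRationalClass c → IsOfHodgeType (2 * p + 1) B (2 * p) p p c →
          c ∈ supportedClasses B (2 * p) 1) →
      (∀ ⦃q m : ℕ⦄ ⦃X : SchemeOver ℂ⦄ (N : CurveNet m X), 2 ≤ q → m + 1 = 2 * q →
        ∀ c : complexBetti N.total (2 * q), IsRationalClass c → IsOfHodgeType (m + 1) N.total (2 * q) q q c →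
          ∃ F : MvPolynomial (Fin (m + 1)) ℂ, F ≠ 0 ∧
            c ∈ classesSupportedOn N.total (N.proj.left.base ⁻¹' projHypersurface m F) (2 * q)) →
      ∀ ⦃q m : ℕ⦄ ⦃X : SchemeOver ℂ⦄ (pr : X ⟶ projectiveSpace m ℂ), IsSmoothProjective (2 * q) X → 2 ≤ q →
        m + 1 = 2 * q → Function.Surjective pr.left.base →
          ∀ c : complexBetti X (2 * q), IsRationalClass c → IsOfHodgeType (2 * q) X (2 * q) q q c →
            ∃ T : Set (projectiveSpace m ℂ).left, IsClosed T ∧ T ≠ Set.univ ∧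
              complexBetti.restrictCompl X (pr.left.base ⁻¹' T) (2 * q) c = 0) →
    (VerticalSupportMiddle ↔
      ((∀ ⦃p : ℕ⦄ ⦃B : SchemeOver ℂ⦄, 1 ≤ p → IsSmoothProjective (2 * p + 1) B →
          ∀ c : complexBetti B (2 * p), IsRationalClass c → IsOfHodgeType (2 * p + 1) B (2 * p) p p c →
            c ∈ supportedClasses B (2 * p) 1) ∧
        ∀ ⦃q m : ℕ⦄ ⦃X : SchemeOver ℂ⦄ (N : CurveNet m X), 2 ≤ q → m + 1 = 2 * q →
          ∀ c : complexBetti N.total (2 * q), IsRationalClass c → IsOfHodgeType (m + 1) N.total (2 * q) q q c →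
            ∃ F : MvPolynomial (Fin (m + 1)) ℂ, F ≠ 0 ∧
              c ∈ classesSupportedOn N.total (N.proj.left.base ⁻¹' projHypersurface m F) (2 * q))) := by
  intro hT
  refine ⟨fun h => ⟨verticalSupportMiddle_imp_coniveau_one_odd h, verticalSupportMiddle_imp_netVerticality h⟩,
    fun h => ?_⟩
  have hGV := hT h.1 h.2
  intro q m X pr hX hq hm hsurj
  refine le_sup_of_le_right (Submodule.span_mono ?_)
  rintro c ⟨hc, hh⟩
  exact ⟨hc, hh, hGV pr hX hq hm hsurj c hc hh⟩

end Summit.HodgeConjecture.HodgeConjecture.Theorems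

end
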